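import Literature.NumberTheory.Irrationality.Fischler2002.Theoreme32ThreeStepProofs
import Literature.NumberTheory.Irrationality.Fischler2002.Theoreme32ThreeRouteProofs
import Literature.NumberTheory.Irrationality.Fischler2002.Theoreme32FourProofs
import HarnessLib

/-!
# Fischler 2002, Théorème 3.2 — the LAST case `n = 3`, and the named fact `theoreme32` DISCHARGED

Topic `Literature/NumberTheory/Irrationality/Fischler2002`. PROOFS ONLY (no definition, no statement). This file closes the `n = 3`
case of the named fact `theoreme32` of `RhinViolaGroupsGeneral.lean` — S. Fischler, « Formes linéaires en polyzêtas et intégrales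
multiples », C. R. Acad. Sci. Paris **335** (2002) §3 Théorème 3.2 [Fischler2002Polyzetas] (= J. Théor. Nombres Bordeaux **15** (2003)
Th. 5–6 [Fischler2003RhinViola]): « Pour `n = 3`, le groupe `G` est isomorphe à `H ⋊ 𝔖₅` … ; il laisse stable
`𝒥(p)/(a₁! a₂! a₃! b₁! b₂! b₃! (a₂+b₃−c₃)! (b₁+b₃−c₃)!)` » — and assembles `theoreme32_holds : theoreme32` (every `n ≥ 2`) with ct-1
g33's `theoreme32_of_ne_three`.

THE ARGUMENT (`n = 3`). By `Theoreme32ThreeDictionaryProofs.lean`, on `𝓔₃` Fischler's family IS Rhin–Viola's (2001) family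
`I(h,j,k,l,m,q,r,s)` (as lower integrals), the criterion is the non-negativity of the eight parameters, and the normaliser is
`h!j!k!l!m!q!r!s!`; so the clause is Rhin–Viola's (4.4) for pairs `P, gP` whose EIGHT parameters (not the sixteen integers) are
non-negative. Every `g ∈ G` acts on the sixteen forms through an affine datum `(s,t) ∈ 𝔖₅ ⋉ 𝔽₂⁴` (`exists_aff_of_mem`); `𝒥₃/N` is
invariant under the FREE moves `σ, ψ, ϑ̃` (Rhin–Viola's `Θ`; `ϑ̃` = the birational `ϑ`, an exact invariance with no sign hypothesis)
and under the hypergeometric involutions `φ, χ₃` and their `Θ`-conjugates between criterion points (`Theoreme32ThreeStepProofs.lean`).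
ROUTING (`route3`, kernel-checked, pattern-free): unless `(s,t)` is the identity, some move `μ` lowers a potential and — for a
conjugate move — lands the two NEW parameter codes of `μ·g` on parameter codes of `p`, so `μ·g·p` satisfies the criterion because its
parameters are parameters of `g·p` or of `p`; induction on the potential (`invariance_three_aux`), the base case being `g = 1`
(`eq_of_aff`). Hence `invariance_three`, `isRhinViolaGroup_three` (with ct-1 g29's `Jn_finite_iff_holds`), the order `1920` being ct-1 g33's
`card_closure_eq_three` (= Rhin–Viola's `|Φ|`): `theoreme32_three`, and `theoreme32_holds`. This also settles ct-1 g33's recon memo §5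
(transport along `σ, ψ, φ` alone is disconnected for `n = 3`: Rhin–Viola's `ϑ` supplies the missing links). Cell `pub-zeta5`, seat
ct-1 g34, 2026-08-28. [cite: Fischler2002Polyzetas, §3 Théorème 3.2] [cite: Fischler2003RhinViola, §3.3 Théorème 5, §3.4 Théorème 6]
[cite: RhinViola2001, §4 (4.4)]

HONEST FRAMING (cell pub-zeta5): systematic search; no irrationality claim unless certified — identities between (possibly infinite)
integrals of non-negative functions and the bookkeeping of a printed group; nothing about the irrationality of `ζ(5)` or `ζ(3)`,
no linear-form / denominator / exponent statement; records in print unmoved.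
-/

noncomputable section

namespace Literature.NumberTheory.Irrationality.Fischler2002

namespace Theoreme32

open Equiv JnFinite
open scoped ENNReal

section ThreeMain

variable {F : Fin 32 → Exponents → ℤ}
  (hF : ∀ (c : Fin 32) (p : Exponents), F c p =
    ![p.b 1, 0, 0, p.b 2, 0, p.a 2 + p.b 2 - p.c 3, p.a 3, 0, 0, p.a 2 + p.b 3 - p.a 1, p.c 3, 0, p.a 2, 0, 0,
      p.a 2 + p.b 2 - p.b 1, 0, p.b 1 + p.b 3 - p.c 3, p.a 1 + p.b 1 - p.a 2, 0, p.a 1 + p.b 1 - p.c 3, 0, 0,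
      p.a 3 + p.b 3 - p.c 3, p.a 1 + p.b 1 - p.a 3, 0, 0, p.b 3, 0, p.a 2 + p.b 3 - p.c 3, p.a 1, 0] c)
  {A : Perm (Fin 5) → Fin 32 → Fin 32 → Fin 32}
  (hA : ∀ (s : Perm (Fin 5)) (t c : Fin 32), A s t c = Fin.ofNat 32
    ((if (Nat.testBit c.val (s.symm 0).val != Nat.testBit t.val 0) then 1 else 0) +
      (if (Nat.testBit c.val (s.symm 1).val != Nat.testBit t.val 1) then 2 else 0) +
      (if (Nat.testBit c.val (s.symm 2).val != Nat.testBit t.val 2) then 4 else 0) +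
      (if (Nat.testBit c.val (s.symm 3).val != Nat.testBit t.val 3) then 8 else 0) +
      (if (Nat.testBit c.val (s.symm 4).val != Nat.testBit t.val 4) then 16 else 0)))
  {POT : Perm (Fin 5) → Fin 32 → ℕ}
  (hPOT : ∀ (s : Perm (Fin 5)) (t : Fin 32), POT s t =
    if 0 < ([(0 : Fin 32), 6, 12, 30, 29, 27, 17, 3].filter (fun u => decide (A s t u ∉ [(0 : Fin 32), 6, 12, 30, 29, 27, 17, 3]))).length
    then 16 + ([(0 : Fin 32), 6, 12, 30, 29, 27, 17, 3].filter (fun u => decide (A s t u ∉ [(0 : Fin 32), 6, 12, 30, 29, 27, 17, 3]))).length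
    else (([((1 : Perm (Fin 5)), (0 : Fin 32), (0 : ℕ)), (swap 0 2 * swap 3 4, 29, 1), (swap 0 2 * swap 2 3 * swap 3 4, 6, 1),
        (swap 3 4 * swap 2 3 * swap 0 2, 3, 1), (swap 0 4 * swap 2 3, 12, 1), (swap 2 4, 30, 2), (swap 0 3, 6, 2), (swap 0 3, 27, 2),
        (swap 0 3 * swap 2 4, 12, 2), (swap 0 3 * swap 2 4, 17, 2), (swap 0 2 * swap 3 4, 0, 3), (swap 0 2 * swap 2 3 * swap 3 4, 27, 3),
        (swap 3 4 * swap 2 3 * swap 0 2, 30, 3), (swap 0 4 * swap 2 3, 17, 3), (1, 29, 4), (swap 2 4, 3, 4)].find?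
        (fun x => decide (x.1 = s) && decide (x.2.1 = t))).map (fun x => x.2.2)).getD 0)
  {MS : Fin 16 → Perm (Fin 5)} {MT MU MV : Fin 16 → Fin 32}
  (hMS : MS = ![swap 2 3, swap 3 4, swap 0 4, swap 0 2, swap 1 2, swap 0 1, swap 1 3, swap 1 2, swap 1 4, swap 1 4, swap 0 1, swap 1 3,
    swap 0 4 * swap 2 3, swap 0 2 * swap 3 4, swap 0 2 * swap 2 3 * swap 3 4, swap 3 4 * swap 2 3 * swap 0 2])
  (hMT : MT = ![0, 0, 0, 5, 0, 3, 10, 6, 0, 18, 0, 0, 12, 29, 6, 3])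
  (hMU : MU = ![10, 9, 15, 5, 5, 15, 10, 23, 15, 9, 5, 9, 0, 0, 0, 0])
  (hMV : MV = ![23, 20, 18, 24, 10, 24, 20, 24, 20, 18, 18, 23, 0, 0, 0, 0])
  {gσ gψ gφ : Perm {p : Exponents // InE 3 p}}

/-! ### The sixteen moves as elements of `⟨σ', ψ', φ'⟩` -/

include hF hA hMS hMT in
/-- **The moves exist in `G = ⟨σ', ψ', φ'⟩` with the tabulated affine data, and each preserves `𝒥₃/N` between criterion points**:
`m < 4`: `Θ`-conjugates of `χ₃`; `4 ≤ m < 12`: `Θ`-conjugates of `φ`; `12 ≤ m`: the free moves `σ, ψ, ϑ̃, ϑ̃⁻¹`.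
[cite: Fischler2002Polyzetas, §3 Théorème 3.2 (n = 3)] [cite: RhinViola2001, §4 pp. 282–286 (Φ = ⟨ϕ, χ, ϑ, σ⟩, level-2 cosets)] -/
theorem moves_exist (hσ : ∀ p, (gσ p).1 = sigma p.1) (hψ : ∀ p, (gψ p).1 = psi 3 p.1) (hφ : ∀ p, (gφ p).1 = phi 3 p.1)
    (m : Fin 16) :
    ∃ μ : Perm {p : Exponents // InE 3 p}, μ ∈ Subgroup.closure ({gσ, gψ, gφ} : Set (Perm {p : Exponents // InE 3 p})) ∧
      (∀ c p, F c (μ p).1 = F (A (MS m) (MT m) c) p.1) ∧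
      ∀ q : {p : Exponents // InE 3 p}, FinitenessCriterionGen 3 q.1 → FinitenessCriterionGen 3 (μ q).1 →
        Jn 3 (μ q).1 / (rvNormaliser 3 (μ q).1 : ℝ≥0∞) = Jn 3 (q).1 / (rvNormaliser 3 (q).1 : ℝ≥0∞) := by
  have mS : gσ ∈ Subgroup.closure ({gσ, gψ, gφ} : Set (Perm {p : Exponents // InE 3 p})) := Subgroup.subset_closure (by simp)
  have mP : gψ ∈ Subgroup.closure ({gσ, gψ, gφ} : Set (Perm {p : Exponents // InE 3 p})) := Subgroup.subset_closure (by simp)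
  have mΦ : gφ ∈ Subgroup.closure ({gσ, gψ, gφ} : Set (Perm {p : Exponents // InE 3 p})) := Subgroup.subset_closure (by simp)
  set T : Perm {p : Exponents // InE 3 p} := gφ * gσ * gφ * gσ * gψ * gσ * gφ * gσ * gφ * gσ * gψ * gσ * gφ with hTdef
  set C : Perm {p : Exponents // InE 3 p} := gψ * gφ * gσ * gφ * gσ * gφ * gσ * gψ with hCdef
  have mT : T ∈ Subgroup.closure ({gσ, gψ, gφ} : Set (Perm {p : Exponents // InE 3 p})) :=
    mul_mem (mul_mem (mul_mem (mul_mem (mul_mem (mul_mem (mul_mem (mul_mem (mul_mem (mul_mem (mul_mem (mul_mem mΦ mS) mΦ) mS) mP)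
      mS) mΦ) mS) mΦ) mS) mP) mS) mΦ
  have mC : C ∈ Subgroup.closure ({gσ, gψ, gφ} : Set (Perm {p : Exponents // InE 3 p})) := mul_mem (mul_mem (mul_mem (mul_mem (mul_mem (mul_mem (mul_mem mP mΦ) mS) mΦ) mS) mΦ) mS) mP
  have hS := aff_sigma hF hA hσ; have hP := aff_psi hF hA hψ; have hΦ := aff_phi hF hA hφ
  have hT : ∀ c p, F c (T p).1 = F (A (swap 0 2 * swap 2 3 * swap 3 4) 6 c) p.1 := aff_thetaWord hF hA hσ hψ hφ
  have hC : ∀ c p, F c (C p).1 = F (A (swap 2 3) 0 c) p.1 := aff_chiWord hF hA hσ hψ hφ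
  have fS := free_sigma hσ; have fP := free_psi hψ
  have fT : ∀ q : {p : Exponents // InE 3 p}, (FinitenessCriterionGen 3 q.1 ↔ FinitenessCriterionGen 3 (T q).1) ∧ (FinitenessCriterionGen 3 q.1 →
      Jn 3 (T q).1 / (rvNormaliser 3 (T q).1 : ℝ≥0∞) = Jn 3 (q).1 / (rvNormaliser 3 (q).1 : ℝ≥0∞)) := free_thetaWord hF hA hσ hψ hφ
  have sΦ := step_phi3 hφ
  have sC : ∀ q : {p : Exponents // InE 3 p}, FinitenessCriterionGen 3 q.1 → FinitenessCriterionGen 3 (C q).1 →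
      Jn 3 (C q).1 / (rvNormaliser 3 (C q).1 : ℝ≥0∞) = Jn 3 (q).1 / (rvNormaliser 3 (q).1 : ℝ≥0∞) := step_chiWord hF hA hσ hψ hφ
  subst hMS hMT
  fin_cases m
  · -- move 0: `C` itself
    show ∃ μ : Perm {p : Exponents // InE 3 p}, μ ∈ _ ∧ (∀ c p, F c (μ p).1 = F (A (swap 2 3) 0 c) p.1) ∧ _
    exact ⟨C, mC, hC, sC⟩
  · -- move 1: θ = T, ξ = C; data (swap 3 4, 0)
    show ∃ μ : Perm {p : Exponents // InE 3 p}, μ ∈ _ ∧ (∀ c p, F c (μ p).1 = F (A (swap 3 4) 0 c) p.1) ∧ _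
    refine ⟨T⁻¹ * C * T, mul_mem (mul_mem (inv_mem (mT)) mC) (mT), ?_, step_conj (fT) sC⟩
    exact aff_congr (aff_mul_A hA (aff_mul_A hA (aff_inv_A hA hT) hC) hT) (fun c => by
      rw [show (swap 0 2 * swap 2 3 * swap 3 4 * (swap 2 3 * (swap 0 2 * swap 2 3 * swap 3 4)⁻¹) : Perm (Fin 5)) = swap 3 4 from by decide,
        show A (swap 0 2 * swap 2 3 * swap 3 4) 6 (A (swap 2 3) 0 (A (swap 0 2 * swap 2 3 * swap 3 4)⁻¹ 0 6)) = (0 : Fin 32) from by simp only [hA]; decide])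
  · -- move 2: θ = P, ξ = C; data (swap 0 4, 0)
    show ∃ μ : Perm {p : Exponents // InE 3 p}, μ ∈ _ ∧ (∀ c p, F c (μ p).1 = F (A (swap 0 4) 0 c) p.1) ∧ _
    refine ⟨gψ⁻¹ * C * gψ, mul_mem (mul_mem (inv_mem (mP)) mC) (mP), ?_, step_conj (fP) sC⟩
    exact aff_congr (aff_mul_A hA (aff_mul_A hA (aff_inv_A hA hP) hC) hP) (fun c => by
      rw [show (swap 0 2 * swap 3 4 * (swap 2 3 * (swap 0 2 * swap 3 4)⁻¹) : Perm (Fin 5)) = swap 0 4 from by decide,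
        show A (swap 0 2 * swap 3 4) 29 (A (swap 2 3) 0 (A (swap 0 2 * swap 3 4)⁻¹ 0 29)) = (0 : Fin 32) from by simp only [hA]; decide])
  · -- move 3: θ = TS, ξ = C; data (swap 0 2, 5)
    show ∃ μ : Perm {p : Exponents // InE 3 p}, μ ∈ _ ∧ (∀ c p, F c (μ p).1 = F (A (swap 0 2) 5 c) p.1) ∧ _
    have hθ1 := aff_congr (aff_mul_A hA hT hS) (τ := A (swap 0 3) 6) (fun c => by
      rw [show (swap 0 4 * swap 2 3 * (swap 0 2 * swap 2 3 * swap 3 4) : Perm (Fin 5)) = swap 0 3 from by decide,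
        show A (swap 0 4 * swap 2 3) 12 (6 : Fin 32) = 6 from by rw [hA]; decide])
    refine ⟨(T * gσ)⁻¹ * C * (T * gσ), mul_mem (mul_mem (inv_mem (mul_mem (mT) mS)) mC) (mul_mem (mT) mS), ?_, step_conj (free_mul (fT) fS) sC⟩
    exact aff_congr (aff_mul_A hA (aff_mul_A hA (aff_inv_A hA hθ1) hC) hθ1) (fun c => by
      rw [show (swap 0 3 * (swap 2 3 * (swap 0 3)⁻¹) : Perm (Fin 5)) = swap 0 2 from by decide,
        show A (swap 0 3) 6 (A (swap 2 3) 0 (A (swap 0 3)⁻¹ 0 6)) = (5 : Fin 32) from by simp only [hA]; decide])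
  · -- move 4: `F` itself
    show ∃ μ : Perm {p : Exponents // InE 3 p}, μ ∈ _ ∧ (∀ c p, F c (μ p).1 = F (A (swap 1 2) 0 c) p.1) ∧ _
    exact ⟨gφ, mΦ, hΦ, sΦ⟩
  · -- move 5: θ = P, ξ = F; data (swap 0 1, 3)
    show ∃ μ : Perm {p : Exponents // InE 3 p}, μ ∈ _ ∧ (∀ c p, F c (μ p).1 = F (A (swap 0 1) 3 c) p.1) ∧ _
    refine ⟨gψ⁻¹ * gφ * gψ, mul_mem (mul_mem (inv_mem (mP)) mΦ) (mP), ?_, step_conj (fP) sΦ⟩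
    exact aff_congr (aff_mul_A hA (aff_mul_A hA (aff_inv_A hA hP) hΦ) hP) (fun c => by
      rw [show (swap 0 2 * swap 3 4 * (swap 1 2 * (swap 0 2 * swap 3 4)⁻¹) : Perm (Fin 5)) = swap 0 1 from by decide,
        show A (swap 0 2 * swap 3 4) 29 (A (swap 1 2) 0 (A (swap 0 2 * swap 3 4)⁻¹ 0 29)) = (3 : Fin 32) from by simp only [hA]; decide])
  · -- move 6: θ = S, ξ = F; data (swap 1 3, 10)
    show ∃ μ : Perm {p : Exponents // InE 3 p}, μ ∈ _ ∧ (∀ c p, F c (μ p).1 = F (A (swap 1 3) 10 c) p.1) ∧ _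
    refine ⟨gσ⁻¹ * gφ * gσ, mul_mem (mul_mem (inv_mem (mS)) mΦ) (mS), ?_, step_conj (fS) sΦ⟩
    exact aff_congr (aff_mul_A hA (aff_mul_A hA (aff_inv_A hA hS) hΦ) hS) (fun c => by
      rw [show (swap 0 4 * swap 2 3 * (swap 1 2 * (swap 0 4 * swap 2 3)⁻¹) : Perm (Fin 5)) = swap 1 3 from by decide,
        show A (swap 0 4 * swap 2 3) 12 (A (swap 1 2) 0 (A (swap 0 4 * swap 2 3)⁻¹ 0 12)) = (10 : Fin 32) from by simp only [hA]; decide])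
  · -- move 7: θ = PT, ξ = F; data (swap 1 2, 6)
    show ∃ μ : Perm {p : Exponents // InE 3 p}, μ ∈ _ ∧ (∀ c p, F c (μ p).1 = F (A (swap 1 2) 6 c) p.1) ∧ _
    have hθ1 := aff_congr (aff_mul_A hA hP hT) (τ := A (swap 0 3) 27) (fun c => by
      rw [show (swap 0 2 * swap 2 3 * swap 3 4 * (swap 0 2 * swap 3 4) : Perm (Fin 5)) = swap 0 3 from by decide,
        show A (swap 0 2 * swap 2 3 * swap 3 4) 6 (29 : Fin 32) = 27 from by rw [hA]; decide])
    refine ⟨(gψ * T)⁻¹ * gφ * (gψ * T), mul_mem (mul_mem (inv_mem (mul_mem (mP) mT)) mΦ) (mul_mem (mP) mT), ?_, step_conj (free_mul (fP) fT) sΦ⟩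
    exact aff_congr (aff_mul_A hA (aff_mul_A hA (aff_inv_A hA hθ1) hΦ) hθ1) (fun c => by
      rw [show (swap 0 3 * (swap 1 2 * (swap 0 3)⁻¹) : Perm (Fin 5)) = swap 1 2 from by decide,
        show A (swap 0 3) 27 (A (swap 1 2) 0 (A (swap 0 3)⁻¹ 0 27)) = (6 : Fin 32) from by simp only [hA]; decide])
  · -- move 8: θ = SP, ξ = F; data (swap 1 4, 0)
    show ∃ μ : Perm {p : Exponents // InE 3 p}, μ ∈ _ ∧ (∀ c p, F c (μ p).1 = F (A (swap 1 4) 0 c) p.1) ∧ _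
    have hθ1 := aff_congr (aff_mul_A hA hS hP) (τ := A (swap 0 3 * swap 2 4) 12) (fun c => by
      rw [show (swap 0 2 * swap 3 4 * (swap 0 4 * swap 2 3) : Perm (Fin 5)) = swap 0 3 * swap 2 4 from by decide,
        show A (swap 0 2 * swap 3 4) 29 (12 : Fin 32) = 12 from by rw [hA]; decide])
    refine ⟨(gσ * gψ)⁻¹ * gφ * (gσ * gψ), mul_mem (mul_mem (inv_mem (mul_mem (mS) mP)) mΦ) (mul_mem (mS) mP), ?_, step_conj (free_mul (fS) fP) sΦ⟩
    exact aff_congr (aff_mul_A hA (aff_mul_A hA (aff_inv_A hA hθ1) hΦ) hθ1) (fun c => by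
      rw [show (swap 0 3 * swap 2 4 * (swap 1 2 * (swap 0 3 * swap 2 4)⁻¹) : Perm (Fin 5)) = swap 1 4 from by decide,
        show A (swap 0 3 * swap 2 4) 12 (A (swap 1 2) 0 (A (swap 0 3 * swap 2 4)⁻¹ 0 12)) = (0 : Fin 32) from by simp only [hA]; decide])
  · -- move 9: θ = PS, ξ = F; data (swap 1 4, 18)
    show ∃ μ : Perm {p : Exponents // InE 3 p}, μ ∈ _ ∧ (∀ c p, F c (μ p).1 = F (A (swap 1 4) 18 c) p.1) ∧ _
    have hθ1 := aff_congr (aff_mul_A hA hP hS) (τ := A (swap 0 3 * swap 2 4) 17) (fun c => by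
      rw [show (swap 0 4 * swap 2 3 * (swap 0 2 * swap 3 4) : Perm (Fin 5)) = swap 0 3 * swap 2 4 from by decide,
        show A (swap 0 4 * swap 2 3) 12 (29 : Fin 32) = 17 from by rw [hA]; decide])
    refine ⟨(gψ * gσ)⁻¹ * gφ * (gψ * gσ), mul_mem (mul_mem (inv_mem (mul_mem (mP) mS)) mΦ) (mul_mem (mP) mS), ?_, step_conj (free_mul (fP) fS) sΦ⟩
    exact aff_congr (aff_mul_A hA (aff_mul_A hA (aff_inv_A hA hθ1) hΦ) hθ1) (fun c => by
      rw [show (swap 0 3 * swap 2 4 * (swap 1 2 * (swap 0 3 * swap 2 4)⁻¹) : Perm (Fin 5)) = swap 1 4 from by decide,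
        show A (swap 0 3 * swap 2 4) 17 (A (swap 1 2) 0 (A (swap 0 3 * swap 2 4)⁻¹ 0 17)) = (18 : Fin 32) from by simp only [hA]; decide])
  · -- move 10: θ = SPS, ξ = F; data (swap 0 1, 0)
    show ∃ μ : Perm {p : Exponents // InE 3 p}, μ ∈ _ ∧ (∀ c p, F c (μ p).1 = F (A (swap 0 1) 0 c) p.1) ∧ _
    have hθ1 := aff_congr (aff_mul_A hA hS hP) (τ := A (swap 0 3 * swap 2 4) 12) (fun c => by
      rw [show (swap 0 2 * swap 3 4 * (swap 0 4 * swap 2 3) : Perm (Fin 5)) = swap 0 3 * swap 2 4 from by decide,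
        show A (swap 0 2 * swap 3 4) 29 (12 : Fin 32) = 12 from by rw [hA]; decide])
    have hθ2 := aff_congr (aff_mul_A hA hθ1 hS) (τ := A (swap 0 2 * swap 3 4) 0) (fun c => by
      rw [show (swap 0 4 * swap 2 3 * (swap 0 3 * swap 2 4) : Perm (Fin 5)) = swap 0 2 * swap 3 4 from by decide,
        show A (swap 0 4 * swap 2 3) 12 (12 : Fin 32) = 0 from by rw [hA]; decide])
    refine ⟨(gσ * gψ * gσ)⁻¹ * gφ * (gσ * gψ * gσ), mul_mem (mul_mem (inv_mem (mul_mem (mul_mem (mS) mP) mS)) mΦ) (mul_mem (mul_mem (mS) mP) mS), ?_, step_conj (free_mul (free_mul (fS) fP) fS) sΦ⟩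
    exact aff_congr (aff_mul_A hA (aff_mul_A hA (aff_inv_A hA hθ2) hΦ) hθ2) (fun c => by
      rw [show (swap 0 2 * swap 3 4 * (swap 1 2 * (swap 0 2 * swap 3 4)⁻¹) : Perm (Fin 5)) = swap 0 1 from by decide,
        show A (swap 0 2 * swap 3 4) 0 (A (swap 1 2) 0 (A (swap 0 2 * swap 3 4)⁻¹ 0 0)) = (0 : Fin 32) from by simp only [hA]; decide])
  · -- move 11: θ = PTS, ξ = F; data (swap 1 3, 0)
    show ∃ μ : Perm {p : Exponents // InE 3 p}, μ ∈ _ ∧ (∀ c p, F c (μ p).1 = F (A (swap 1 3) 0 c) p.1) ∧ _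
    have hθ1 := aff_congr (aff_mul_A hA hP hT) (τ := A (swap 0 3) 27) (fun c => by
      rw [show (swap 0 2 * swap 2 3 * swap 3 4 * (swap 0 2 * swap 3 4) : Perm (Fin 5)) = swap 0 3 from by decide,
        show A (swap 0 2 * swap 2 3 * swap 3 4) 6 (29 : Fin 32) = 27 from by rw [hA]; decide])
    have hθ2 := aff_congr (aff_mul_A hA hθ1 hS) (τ := A (swap 0 2 * swap 2 3 * swap 3 4) 27) (fun c => by
      rw [show (swap 0 4 * swap 2 3 * (swap 0 3) : Perm (Fin 5)) = swap 0 2 * swap 2 3 * swap 3 4 from by decide,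
        show A (swap 0 4 * swap 2 3) 12 (27 : Fin 32) = 27 from by rw [hA]; decide])
    refine ⟨(gψ * T * gσ)⁻¹ * gφ * (gψ * T * gσ), mul_mem (mul_mem (inv_mem (mul_mem (mul_mem (mP) mT) mS)) mΦ) (mul_mem (mul_mem (mP) mT) mS), ?_, step_conj (free_mul (free_mul (fP) fT) fS) sΦ⟩
    exact aff_congr (aff_mul_A hA (aff_mul_A hA (aff_inv_A hA hθ2) hΦ) hθ2) (fun c => by
      rw [show (swap 0 2 * swap 2 3 * swap 3 4 * (swap 1 2 * (swap 0 2 * swap 2 3 * swap 3 4)⁻¹) : Perm (Fin 5)) = swap 1 3 from by decide,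
        show A (swap 0 2 * swap 2 3 * swap 3 4) 27 (A (swap 1 2) 0 (A (swap 0 2 * swap 2 3 * swap 3 4)⁻¹ 0 27)) = (0 : Fin 32) from by simp only [hA]; decide])
  · -- move 12: `σ` (free)
    show ∃ μ : Perm {p : Exponents // InE 3 p}, μ ∈ _ ∧ (∀ c p, F c (μ p).1 = F (A (swap 0 4 * swap 2 3) 12 c) p.1) ∧ _
    exact ⟨gσ, mS, hS, fun q hc _ => (fS q).2 hc⟩
  · -- move 13: `ψ` (free)
    show ∃ μ : Perm {p : Exponents // InE 3 p}, μ ∈ _ ∧ (∀ c p, F c (μ p).1 = F (A (swap 0 2 * swap 3 4) 29 c) p.1) ∧ _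
    exact ⟨gψ, mP, hP, fun q hc _ => (fP q).2 hc⟩
  · -- move 14: `ϑ̃` (free)
    show ∃ μ : Perm {p : Exponents // InE 3 p}, μ ∈ _ ∧ (∀ c p, F c (μ p).1 = F (A (swap 0 2 * swap 2 3 * swap 3 4) 6 c) p.1) ∧ _
    exact ⟨T, mT, hT, fun q hc _ => (fT q).2 hc⟩
  · -- move 15: `ϑ̃⁻¹` (free); data ((0 2 3 4)⁻¹, 3)
    show ∃ μ : Perm {p : Exponents // InE 3 p}, μ ∈ _ ∧ (∀ c p, F c (μ p).1 = F (A (swap 3 4 * swap 2 3 * swap 0 2) 3 c) p.1) ∧ _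
    refine ⟨T⁻¹, inv_mem mT, ?_, fun q hc _ => (free_inv fT q).2 hc⟩
    exact aff_congr (aff_inv_A hA hT) (fun c => by
      rw [show ((swap 0 2 * swap 2 3 * swap 3 4)⁻¹ : Perm (Fin 5)) = swap 3 4 * swap 2 3 * swap 0 2 from by decide,
        show A (swap 3 4 * swap 2 3 * swap 0 2) 0 (6 : Fin 32) = 3 from by rw [hA]; decide])

/-! ### The induction on the potential -/

include hF hA hPOT hMS hMT hMU hMV in
/-- **Main induction** (`n = 3`): for `g ∈ G` acting through `(s,t)` (`t` even), and `p, gp` both in the criterion,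
`𝒥₃(gp)/N(gp) = 𝒥₃(p)/N(p)` — by strong induction on the potential of `(s,t)`, using `route3` and `moves_exist`; base case `(1,0)`:
then `g = 1` (`eq_of_aff`). [cite: Fischler2002Polyzetas, §3 Théorème 3.2 (n = 3)] [cite: RhinViola2001, §4 (4.4)] -/
theorem invariance_three_aux (hσ : ∀ p, (gσ p).1 = sigma p.1) (hψ : ∀ p, (gψ p).1 = psi 3 p.1) (hφ : ∀ p, (gφ p).1 = phi 3 p.1)
    (N : ℕ) : ∀ (g : Perm {p : Exponents // InE 3 p}), g ∈ Subgroup.closure ({gσ, gψ, gφ} : Set (Perm {p : Exponents // InE 3 p})) → ∀ (s : Perm (Fin 5)) (t : Fin 32),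
      t ∈ [(0 : Fin 32), 3, 5, 6, 9, 10, 12, 15, 17, 18, 20, 23, 24, 27, 29, 30] → (∀ c p, F c (g p).1 = F (A s t c) p.1) →
      POT s t = N → ∀ p : {p : Exponents // InE 3 p}, FinitenessCriterionGen 3 p.1 → FinitenessCriterionGen 3 (g p).1 →
        Jn 3 (g p).1 / (rvNormaliser 3 (g p).1 : ℝ≥0∞) = Jn 3 (p).1 / (rvNormaliser 3 (p).1 : ℝ≥0∞) := by
  induction N using Nat.strong_induction_on with
  | _ N ih =>
    intro g hg s t ht hrel hN p hc hcg
    by_cases hid : s = 1 ∧ t = 0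
    · -- base: `g` acts as the identity on the forms, hence `g = 1`
      obtain ⟨rfl, rfl⟩ := hid
      have h1 : ∀ c (p : {p : Exponents // InE 3 p}), F c ((1 : Perm {p : Exponents // InE 3 p}) p).1 = F (A 1 0 c) p.1 := fun c p => by rw [A_one hA]; rfl
      rw [eq_of_aff hF hσ hψ hφ hg (Subgroup.one_mem _) hrel h1]
      rfl
    · obtain ⟨m, hnew, hlt⟩ := route3 hA hPOT hMS hMT hMU hMV s ht hid
      obtain ⟨μ, hμG, hμA, hμstep⟩ := moves_exist hF hA hMS hMT hσ hψ hφ m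
      -- the criterion for `μ (g p)`: its parameters are parameters of `g p` or of `p`
      have hcodes : ∀ u ∈ [(0 : Fin 32), 6, 12, 30, 29, 27, 17, 3],
          A (MS m) (MT m) u ∈ [(0 : Fin 32), 6, 12, 30, 29, 27, 17, 3] ∨ A s t (A (MS m) (MT m) u) ∈ [(0 : Fin 32), 6, 12, 30, 29, 27, 17, 3] := by
        intro u hu
        by_cases hm : m.val < 12
        · rcases moves_new_codes hA hMS hMT hMU hMV m hm u hu with h | h | h
          · exact Or.inl h
          · rw [h]; exact Or.inr (hnew hm).1
          · rw [h]; exact Or.inr (hnew hm).2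
        · exact Or.inl (moves_free_codes hA hMS hMT m (not_lt.1 hm) u hu)
      have hcμ : FinitenessCriterionGen 3 (μ (g p)).1 := by
        rw [crit3_iff_forms hF] at hc hcg ⊢
        intro u hu
        rw [hμA]
        rcases hcodes u hu with h | h
        · exact hcg _ h
        · rw [hrel]; exact hc _ h
      -- the induction hypothesis for `μ * g`
      have hIH := ih (POT (s * MS m) (A s t (MT m))) (hN ▸ hlt) (μ * g) (mul_mem hμG hg) (s * MS m) (A s t (MT m))
        (A_even hA s (moves_even hMT m) ht) (aff_mul_A hA hμA hrel) rfl p hc (by rw [Perm.mul_apply]; exact hcμ)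
      rw [Perm.mul_apply] at hIH
      exact (hμstep (g p) hcg hcμ).symm.trans hIH

end ThreeMain

/-! ### The clauses of Théorème 3.2 for `n = 3` -/

/-- **Invariance of `𝒥(p)/(a₁!a₂!a₃!b₁!b₂!b₃!(a₂+b₃−c₃)!(b₁+b₃−c₃)!)` on criterion pairs, `n = 3`** — the last typed clause of `theoreme32`
for `n = 3` (the free symbols of the bricks instantiated by their tables). [cite: Fischler2002Polyzetas, §3 Théorème 3.2 (n = 3)]
[cite: Fischler2003RhinViola, §3.3 Théorème 5] [cite: RhinViola2001, §4 (4.4)] -/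
theorem invariance_three {gσ gψ gφ : Perm {p : Exponents // InE 3 p}}
    (hσ : ∀ p, (gσ p).1 = sigma p.1) (hψ : ∀ p, (gψ p).1 = psi 3 p.1) (hφ : ∀ p, (gφ p).1 = phi 3 p.1)
    {g : Perm {p : Exponents // InE 3 p}} (hg : g ∈ Subgroup.closure ({gσ, gψ, gφ} : Set (Perm {p : Exponents // InE 3 p}))) (p : {p : Exponents // InE 3 p})
    (hc : FinitenessCriterionGen 3 p.1) (hcg : FinitenessCriterionGen 3 (g p).1) :
    Jn 3 (g p).1 / (rvNormaliser 3 (g p).1 : ℝ≥0∞) = Jn 3 (p).1 / (rvNormaliser 3 (p).1 : ℝ≥0∞) := by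
  obtain ⟨s, t, ht, hrel⟩ := exists_aff_of_mem (F := fun c p =>
    ![p.b 1, 0, 0, p.b 2, 0, p.a 2 + p.b 2 - p.c 3, p.a 3, 0, 0, p.a 2 + p.b 3 - p.a 1, p.c 3, 0, p.a 2, 0, 0,
      p.a 2 + p.b 2 - p.b 1, 0, p.b 1 + p.b 3 - p.c 3, p.a 1 + p.b 1 - p.a 2, 0, p.a 1 + p.b 1 - p.c 3, 0, 0,
      p.a 3 + p.b 3 - p.c 3, p.a 1 + p.b 1 - p.a 3, 0, 0, p.b 3, 0, p.a 2 + p.b 3 - p.c 3, p.a 1, 0] c)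
    (A := fun s t c => Fin.ofNat 32
      ((if (Nat.testBit c.val (s.symm 0).val != Nat.testBit t.val 0) then 1 else 0) +
        (if (Nat.testBit c.val (s.symm 1).val != Nat.testBit t.val 1) then 2 else 0) +
        (if (Nat.testBit c.val (s.symm 2).val != Nat.testBit t.val 2) then 4 else 0) +
        (if (Nat.testBit c.val (s.symm 3).val != Nat.testBit t.val 3) then 8 else 0) +
        (if (Nat.testBit c.val (s.symm 4).val != Nat.testBit t.val 4) then 16 else 0)))
    (fun _ _ => rfl) (fun _ _ _ => rfl) hσ hψ hφ hg
  exact invariance_three_aux (fun _ _ => rfl) (fun _ _ _ => rfl) (fun _ _ => rfl) rfl rfl rfl rfl hσ hψ hφ _ g hg s t ht hrel rfl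
    p hc hcg

/-- **The Rhin–Viola property for `n = 3`**: `G = ⟨σ', ψ', φ'⟩` is a Rhin–Viola group for `(𝒥(p))_{p ∈ 𝓔₃}` — whenever `𝒥(p)` and
`𝒥(gp)` are both finite their ratio is the (positive) rational `N(gp)/N(p)` (finiteness ⟺ criterion: ct-1 g29's `Jn_finite_iff_holds`).
[cite: Fischler2002Polyzetas, §3 Théorème 3.2 (n = 3) and Définition 1.1] [cite: Fischler2003RhinViola, Introduction p. 481] -/
theorem isRhinViolaGroup_three {gσ gψ gφ : Perm {p : Exponents // InE 3 p}}
    (hσ : ∀ p, (gσ p).1 = sigma p.1) (hψ : ∀ p, (gψ p).1 = psi 3 p.1) (hφ : ∀ p, (gφ p).1 = phi 3 p.1) :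
    IsRhinViolaGroup (fun p : {p : Exponents // InE 3 p} => Jn 3 p.1) (Subgroup.closure ({gσ, gψ, gφ} : Set (Perm {p : Exponents // InE 3 p}))) := by
  intro g hg p hp hgp
  have hc : FinitenessCriterionGen 3 p.1 := (Jn_finite_iff_holds 3 p.1 (by norm_num)).1 hp
  have hcg : FinitenessCriterionGen 3 (g p).1 := (Jn_finite_iff_holds 3 (g p).1 (by norm_num)).1 hgp
  have ht := invariance_three hσ hψ hφ hg p hc hcg
  have hN := rvNormaliser_pos 3 p.1
  have hN' := rvNormaliser_pos 3 (g p).1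
  refine ⟨(rvNormaliser 3 (g p).1 : ℚ) / rvNormaliser 3 p.1, ?_⟩
  have hcast : (((rvNormaliser 3 (g p).1 : ℚ) / rvNormaliser 3 p.1 : ℚ) : ℝ) =
      (rvNormaliser 3 (g p).1 : ℝ) / (rvNormaliser 3 p.1 : ℝ) := by push_cast; rfl
  rw [hcast, ENNReal.ofReal_div_of_pos (by exact_mod_cast hN), ENNReal.ofReal_natCast, ENNReal.ofReal_natCast]
  rw [ENNReal.div_eq_div_iff (by exact_mod_cast hN.ne') (ENNReal.natCast_ne_top _) (by exact_mod_cast hN'.ne')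
    (ENNReal.natCast_ne_top _)] at ht
  calc Jn 3 (g p).1 = (rvNormaliser 3 (g p).1 : ℝ≥0∞) * Jn 3 p.1 / (rvNormaliser 3 p.1 : ℝ≥0∞) :=
        (ENNReal.eq_div_iff (by exact_mod_cast hN.ne') (ENNReal.natCast_ne_top _)).2 ht
    _ = (rvNormaliser 3 (g p).1 : ℝ≥0∞) / (rvNormaliser 3 p.1 : ℝ≥0∞) * Jn 3 p.1 := by
        rw [mul_comm (rvNormaliser 3 (g p).1 : ℝ≥0∞), mul_div_assoc, mul_comm]

/-- **Fischler's Théorème 3.2 for `n = 3` — ALL CLAUSES**: restricted permutations, the Rhin–Viola property of `⟨σ',ψ',φ'⟩ ≅ H ⋊ 𝔖₅`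
for `(𝒥(p))_{p∈𝓔₃}`, the order `1920 = rvGroupOrder 3` (ct-1 g33's `card_closure_eq_three`, = Rhin–Viola's `|Φ|`), and the invariance of
`𝒥(p)/(a₁! a₂! a₃! b₁! b₂! b₃! (a₂+b₃−c₃)! (b₁+b₃−c₃)!)` on criterion pairs. [cite: Fischler2002Polyzetas, §3 Théorème 3.2]
[cite: Fischler2003RhinViola, §3.3 Théorème 5, §3.4 Théorème 6 (n = 3: H ⋊ 𝔖₅, ordre 1920)] -/
theorem theoreme32_three :
    ∃ σ' ψ' φ' : Equiv.Perm {p : Exponents // InE 3 p},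
      (∀ p, (σ' p).1 = sigma p.1) ∧ (∀ p, (ψ' p).1 = psi 3 p.1) ∧ (∀ p, (φ' p).1 = phi 3 p.1) ∧
      IsRhinViolaGroup (fun p => Jn 3 p.1)
        (Subgroup.closure ({σ', ψ', φ'} : Set (Equiv.Perm {p : Exponents // InE 3 p}))) ∧
      Nat.card (Subgroup.closure ({σ', ψ', φ'} : Set (Equiv.Perm {p : Exponents // InE 3 p}))) = rvGroupOrder 3 ∧
      ∀ g ∈ Subgroup.closure ({σ', ψ', φ'} : Set (Equiv.Perm {p : Exponents // InE 3 p})),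
        ∀ p : {p : Exponents // InE 3 p},
          FinitenessCriterionGen 3 p.1 → FinitenessCriterionGen 3 (g p).1 →
            Jn 3 (g p).1 / (rvNormaliser 3 (g p).1 : ℝ≥0∞) = Jn 3 p.1 / (rvNormaliser 3 p.1 : ℝ≥0∞) := by
  obtain ⟨σ', ψ', φ', hσ, hψ, hφ⟩ := exists_perms (n := 3) (by norm_num)
  exact ⟨σ', ψ', φ', hσ, hψ, hφ, isRhinViolaGroup_three hσ hψ hφ, card_closure_eq_three hσ hψ hφ,
    fun g hg p hc hcg => invariance_three hσ hψ hφ hg p hc hcg⟩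

end Theoreme32

/-- **Fischler 2002, Théorème 3.2 — PROVED** (discharge of the named fact `theoreme32` of `RhinViolaGroupsGeneral.lean`, every
`n ≥ 2`): `σ, ψ, φ` restrict to permutations of `𝓔`; the group they generate is a Rhin–Viola group for `(𝒥(p))_{p∈𝓔}` of order
`120 / 1920 / 72` (`n = 2 / 3 / ≥ 4`) and leaves `𝒥(p)` divided by the printed normalising factorials invariant on criterion pairs. The cases
`n ≠ 3` are seat ct-1 g33's `Theoreme32.theoreme32_of_ne_three`; `n = 3` is `Theoreme32.theoreme32_three` above (via Rhin–Viola 2001).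
[cite: Fischler2002Polyzetas, §3 Théorème 3.2] [cite: Fischler2003RhinViola, §3.3 Théorème 5, §3.4 Théorème 6] -/
theorem theoreme32_holds : theoreme32 := by
  intro n hn
  rcases eq_or_ne n 3 with rfl | h3
  · exact Theoreme32.theoreme32_three
  · exact Theoreme32.theoreme32_of_ne_three n hn h3

end Literature.NumberTheory.Irrationality.Fischler2002

end
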